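import Literature.MathematicalPhysics.QuantumFieldTheory.King1986.PropagatorDerivSupNorm
import Literature.MathematicalPhysics.QuantumFieldTheory.Balaban1983to89.B4Thm19ZeroTorusUniform

/-!
# King 1986 ∕ [Ba 4] (1.9), THE HÖLDER CLAUSE OF THE DERIVATIVE, IN KING'S SPELLING AND SUP-NORM OPERATOR FORM, mass-uniform:
# `|x₁ − x₂|^{−α}·|∂^η_μ(A₀⁻¹f)(x₂) − ∂^η_μ(A₀⁻¹f)(x₁)| ≤ c₀·e^{−δ₀·dist({x₁,x₂}, supp f)}·‖f‖_∞`, `0 ≤ α < 1`,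
# for EVERY volume, EVERY number of levels, EVERY mass under the cap

TEMPLATE LITERATURE, `A = 0`.  [Balaban1983RegularityDecay] Theorem (1.9) p. 573 prints, for the propagator `G_k(Ω, A) = (−Δ_A + m² +
a_kP_k(A))⁻¹` of (1.6), `α < 1` and a function `f`, the Hölder estimate
`(1/|x − x′|^α)|U(A(Γ_{x,x′}))(D^η_{A,μ}G_k(Ω, A)f)(x′) − (D^η_{A,μ}G_k(Ω, A)f)(x)| ≤ c₀exp(−δ₀ dist({x, x′}, supp f))‖f‖_∞` with
`δ₀, c₀` depending on `d`, `L` (and the mass cap), `c₀` on `α`; C. King's Theorem 3.3 (3.8) p. 656 quotes it for his scalar model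
(«(1/|x − y|^α)|(∇^ε_AG_k(A)f)(x) − (∇^ε_AG_k(A)f)(y)| ≤ Cexp[−δ₀dist({x, y}, supp f)]‖f‖», «see [Ba 4]»).  The tree's kernel-checked
`A = 0` torus edition is `B4Thm19ZeroTorus(Uniform).thm19_zero_torus(_unif)` (`0 ≤ α < 1`; the floor-less reading is false,
`B4Thm19ZeroBoxNegAlpha`), stated on the TOWER labels `Site P 0`; `PropagatorDerivSupNorm` transported the sup clause (1.10)₂ to King's
spelling `(fineOp N M a_K N² m²)⁻¹ *ᵥ f` on `Tor (fine N M)`.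

THIS FILE = (1.9) IN KING'S SPELLING, operator form, no point-source price:
* `tdistT_toTor` — the fine-site dictionary is an ISOMETRY: `tdistT (fine L^K M) (toTor x) (toTor z) = T P 0 x z` (both are
  `max_μ dist(x_μ − z_μ, L^KM_μℤ)` on the same labels, `L^KM_μ = sitesPerDir 0`; twin of `MinimizerBlockDecay.tdistT_toTorUnit`);
* `eps_mul_T_eq` — the print's `|x₁ − x₂|_η = ε|x₁ − x₂|_T` is King's `holdist`-type quotient `tdistT (fine N M) x₁ x₂ ∕ N`;
* **`fineOp_inv_deriv_holder_le_unif`** — `∀ 0 ≤ α < 1 ∃ c₀ > 0 ∀ 0 ≤ m² ≤ m₀² ∀ volumes (K ≥ 1) ∀ N = L^K ∀ f, |f| ≤ F ∀ x₁ ≠ x₂ ∀ μ: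
  (|x₁ − x₂|_{fine}∕N)^{−α}·|N[(A₀⁻¹f)(x₂ + e_μ) − (A₀⁻¹f)(x₂)] − N[(A₀⁻¹f)(x₁ + e_μ) − (A₀⁻¹f)(x₁)]| ≤ c₀·F`;
* **`fineOp_inv_deriv_holder_decay_unif`** — the same `× e^{−δ₀D}` for sources vanishing on the fine points whose unit block is within
  torus distance `< D` of the block of `x₁` OR of the block of `x₂` (block currency for «dist({x, x′}, supp f)»; the slack `e^{2δ₀}` of
  `T_blk_le_eps_mul` is in `c₀`).
* §3 `fineOp_inv_deriv_holder_kernel_blocks_unif`, `constrainedProp_deriv_holder_blocks_unif` — the KERNEL of `A₀⁻¹` and of King's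
  `G^ε_K = N^d·A₀⁻¹` in lattice units (point source `f = δ_y`; decay in `min(|B(x₁) − B(y)|, |B(x₂) − B(y)|)`; the factor `N^d` is honest and is
  consumed only at the bottom level `N = L` of the Summits-side induction).
Proofs = `PropagatorDerivSupNorm` §2 ∕ `PropagatorDecayUniform` §4 verbatim with `thm19_zero_torus_unif'` and the derivative bridge
`fineOp_inv_deriv_mulVec_toTor` at the two observation points.

WHY (cell `pub-ymgap`, node N15 = NE2, King-model rung PART U «the C^{1,α} layer»): (i) this IS the [B9] (3.43)-type Hölder entry of
`∇Gλ` (the printed `‖ζ∇_UGλ‖_β`, `0 ≤ β ≤ β₀ < 1`, Thm 3.1 (3.43) p. 398; v1.1: locator corrected from «(3.44)», which is the SUP entry of `∇_UG∇*_Uλ`) at `U ≡ 1` for King's ∕ Bałaban's full `A = 0` propagator `A₀⁻¹ = G_K(T_ε, 0)` at EVERY number of levels (operator level — no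
peel needed); (ii) the Summits-side KERNEL-level C^{1,α} profile uses it with a point source for the fine run at the bottom of its
induction on the number of levels; (iii) the η-RATE of the entry interpolates it with the printed-shape sup rate.

HONEST SCOPE.  (i) `A = 0`, periodic b.c., Bałaban's volumes `M_μ = 2L^m` (`sitesPerDir`), odd `L > 1`, `0 ≤ m² ≤ m₀²`, `0 ≤ α < 1` (no
`α = 1`, no `α < 0`); (ii) forward derivative in the OBSERVATION point only (what (1.9) prints); no `G∇*` clause; (iii) block-distance
currency in the decay form; (iv) sup torus distance for `|x₁ − x₂|` (the Euclidean one of the print is between it and `√(d)` times it: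
a change of `c₀` by at most `d^{α∕2}`).  HONEST FRAMING: King's `A = 0` scalar MODEL on finite tori; template literature; nothing about
Bałaban's covariant `G_k(U)`; nothing continuum ∕ ℝ⁴ ∕ OS ∕ mass-gap ∕ Clay; count-neutral.
Locators: [Balaban1983RegularityDecay] T. Bałaban, CMP **89** (1983) 571–597, Theorem (1.9) p. 573, (1.6) p. 572; [King1986] C. King, CMP
**102** (1986) 649–677, Theorem 3.3 (3.8) p. 656, (3.62) p. 663, (2.13) p. 653, (4.1)–(4.5) p. 670.
-/

noncomputable section

open Finset Real Matrix
open scoped BigOperators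

namespace Literature.MathematicalPhysics.QuantumFieldTheory.King1986

open Literature.MathematicalPhysics.QuantumFieldTheory.Balaban1983to89 (Params)
open Literature.MathematicalPhysics.QuantumFieldTheory.Balaban1983to89.B5Prop11Plancherel
open Literature.MathematicalPhysics.QuantumFieldTheory.Balaban1983to89.B1RG242Torus (tower deriv deriv_mulVec)
open Literature.MathematicalPhysics.QuantumFieldTheory.Balaban1983to89.B4TorusKernel.MultiPeriod (circAbs)
open Literature.MathematicalPhysics.QuantumFieldTheory.Balaban1983to89.B5Ineq137Torus (T blk)

namespace Torus

variable {d : ℕ}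

/-! ## §1 The fine-site dictionary is an isometry; the print's `|x₁ − x₂|_η` -/

/-- **`toTor` preserves the sup torus distance**: `tdistT (fine L^K M) (toTor x) (toTor z) = |x − z|_{T_ε}` (both are
`max_μ dist(x_μ − z_μ, (L^KM_μ)ℤ)` on the same labels, `L^KM_μ = sitesPerDir 0` — the two typings of B12's fine torus `T_ε` (0.1); twin of
`MinimizerBlockDecay.tdistT_toTorUnit`). [cite: Balaban1987RG1, (0.1) p.251] -/
theorem tdistT_toTor (P : Params) (M : Fin P.d → ℕ) [∀ μ, NeZero (M μ)] (hMK : ∀ μ, M μ = P.sitesPerDir P.K)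
    (x z : Balaban1983to89.Site P 0) :
    tdistT (fine (P.L ^ P.K) M) (toTor P M hMK x) (toTor P M hMK z) = T P 0 x z := by
  have hcc : ∀ μ, Balaban1983to89.B4Sect5Torus.ccoord (fine (P.L ^ P.K) M) (toSite (fine (P.L ^ P.K) M) (toTor P M hMK x))
        (toSite (fine (P.L ^ P.K) M) (toTor P M hMK z)) μ
      = Balaban1983to89.B4Sect5Torus.ccoord (Balaban1983to89.B5Ineq137Torus.Nv P 0)
          (Balaban1983to89.B5Ineq137Torus.toT x) (Balaban1983to89.B5Ineq137Torus.toT z) μ := by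
    intro μ
    show (circAbs (fine (P.L ^ P.K) M μ) ((((toTor P M hMK x μ).val : ℕ) : ℤ) - (((toTor P M hMK z μ).val : ℕ) : ℤ))).toNat
      = (circAbs (P.sitesPerDir 0) ((((x μ).val : ℕ) : ℤ) - (((z μ).val : ℕ) : ℤ))).toNat
    rw [val_toTor, val_toTor, ← sitesPerDir_zero_eq_fine P M hMK μ]
  unfold tdistT Balaban1983to89.B5Ineq137Torus.T Balaban1983to89.B4Sect5Torus.tdist
  rw [Finset.sup_congr rfl (fun μ _ => hcc μ)]

/-- `ε⁻¹ = N` for any spelling `N = L^K` of the fine torus: `ε = N⁻¹`. [cite: Balaban1987RG1, (0.1) p.251] -/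
theorem eps_eq_inv_cast (P : Params) : P.eps = ((((P.L ^ P.K : ℕ) : ℝ)))⁻¹ := by
  rw [Params.eps, inv_pow]; push_cast; rfl

/-- **The print's `|x₁ − x₂|_η = ε|x₁ − x₂|_T` in King's spelling**: `ε·T(x₁, x₂) = tdistT (fine L^K M) (toTor x₁) (toTor x₂) ∕ L^K` — the
sup torus distance of the fine points in UNIT coordinates (King's `|x − y|` of (3.62), `MinimizerTwoSpacingHolder.holdist`).
[cite: King1986, (3.62) p.663; Balaban1983RegularityDecay, Theorem (1.9) p.573] -/
theorem eps_mul_T_eq (P : Params) (M : Fin P.d → ℕ) [∀ μ, NeZero (M μ)] (hMK : ∀ μ, M μ = P.sitesPerDir P.K)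
    (x₁ x₂ : Balaban1983to89.Site P 0) :
    P.eps * T P 0 x₁ x₂
      = tdistT (fine (P.L ^ P.K) M) (toTor P M hMK x₁) (toTor P M hMK x₂) / (((P.L ^ P.K : ℕ) : ℝ)) := by
  rw [tdistT_toTor, eps_eq_inv_cast, div_eq_inv_mul]

/-- The weight bookkeeping: `((ε·T)⁻¹)^α = (tdistT∕N)^{−α}` (private plumbing). [folklore] -/
private theorem weight_eq_rpow_neg (P : Params) (M : Fin P.d → ℕ) [∀ μ, NeZero (M μ)] (hMK : ∀ μ, M μ = P.sitesPerDir P.K)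
    (x₁ x₂ : Balaban1983to89.Site P 0) (α : ℝ) :
    ((P.eps * T P 0 x₁ x₂)⁻¹) ^ α
      = (tdistT (fine (P.L ^ P.K) M) (toTor P M hMK x₁) (toTor P M hMK x₂) / (((P.L ^ P.K : ℕ) : ℝ))) ^ (-α) := by
  rw [eps_mul_T_eq P M hMK]
  have h0 : 0 ≤ tdistT (fine (P.L ^ P.K) M) (toTor P M hMK x₁) (toTor P M hMK x₂) / (((P.L ^ P.K : ℕ) : ℝ)) :=
    div_nonneg (tdistT_nonneg _ _ _) (Nat.cast_nonneg _)
  rw [Real.inv_rpow h0, Real.rpow_neg h0]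

/-! ## §2 (1.9), sup-norm operator form, King's spelling -/

/-- **[Ba 4] (1.9) ∕ King's Theorem 3.3 (3.8), THE HÖLDER CLAUSE OF THE DERIVATIVE, OPERATOR FORM, mass-uniform**: for `0 ≤ α < 1`,
`∃ c₀ > 0` (function of `d, L, a, m₀², α`) such that for EVERY `0 ≤ m² ≤ m₀²`, every volume `(d, L, m, K)` with `K ≥ 1`, any spelling
`N = L^K`, every `f` on the fine torus with `|f| ≤ F`, all fine points `x₁ ≠ x₂` and every direction `μ`:
`(|x₁ − x₂|∕N)^{−α}·|N·(((fineOp N M a_K N² m²)⁻¹ f)(x₂ + e_μ) − (…)(x₂)) − N·((…)(x₁ + e_μ) − (…)(x₁))| ≤ c₀·F` — the Hölder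
quotient (exponent `α`, unit coordinates `|x₁ − x₂|∕N` = King's `|x − y|` of (3.62)) of the forward η-derivative `∂^η_μ A₀⁻¹f`
(`η⁻¹ = N`) is bounded in sup norm, uniformly in the number of levels (`thm19_zero_torus_unif'` at `D = 0`, read through
`fineOp_inv_deriv_mulVec_toTor` at both observation points and the isometry `tdistT_toTor`).
[cite: Balaban1983RegularityDecay, Theorem (1.9) p.573; King1986, Theorem 3.3 (3.8) p.656, (3.62) p.663] -/
theorem fineOp_inv_deriv_holder_le_unif (dd L : ℕ) (hd : 1 ≤ dd) (hL : Odd L ∧ 1 < L) {a : ℝ} (ha : 0 < a) {m0sq : ℝ}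
    (hm0 : 0 ≤ m0sq) {α : ℝ} (hα0 : 0 ≤ α) (hα1 : α < 1) :
    ∃ c₀ : ℝ, 0 < c₀ ∧ ∀ (P : Params), P.d = dd → P.L = L → 1 ≤ P.K →
      ∀ (msq : ℝ), 0 ≤ msq → msq ≤ m0sq →
      ∀ (M : Fin P.d → ℕ) [∀ μ, NeZero (M μ)] (_hMK : ∀ μ, M μ = P.sitesPerDir P.K)
        (N : ℕ) [NeZero N] (_hN : N = P.L ^ P.K) (f : Tor (fine N M) → ℝ) (F : ℝ), (∀ y, |f y| ≤ F) →
        ∀ (xt₁ xt₂ : Tor (fine N M)), xt₂ ≠ xt₁ → ∀ (μ : Fin P.d),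
        (tdistT (fine N M) xt₁ xt₂ / N) ^ (-α) *
          |(N : ℝ) * (((fineOp N M (aK a P.L P.K) (((N : ℕ) : ℝ) ^ 2) msq)⁻¹ *ᵥ f) (xt₂ + unitVec (fine N M) μ)
              - ((fineOp N M (aK a P.L P.K) (((N : ℕ) : ℝ) ^ 2) msq)⁻¹ *ᵥ f) xt₂)
            - (N : ℝ) * (((fineOp N M (aK a P.L P.K) (((N : ℕ) : ℝ) ^ 2) msq)⁻¹ *ᵥ f) (xt₁ + unitVec (fine N M) μ)
              - ((fineOp N M (aK a P.L P.K) (((N : ℕ) : ℝ) ^ 2) msq)⁻¹ *ᵥ f) xt₁)| ≤ c₀ * F := by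
  obtain ⟨δ₀, c₀, hδ₀, hc₀, H⟩ :=
    Balaban1983to89.B4Thm19ZeroTorus.thm19_zero_torus_unif' dd L hd hL ha hm0 hα0 hα1
  refine ⟨c₀, hc₀, ?_⟩
  intro P hPd hPL hK msq hmsq hcap M _ hMK N _ hN f F hF xt₁ xt₂ hne μ
  subst hN
  set x₁ : Balaban1983to89.Site P 0 := (torEquiv P M hMK).symm xt₁ with hx₁def
  set x₂ : Balaban1983to89.Site P 0 := (torEquiv P M hMK).symm xt₂ with hx₂def
  have hxt₁ : toTor P M hMK x₁ = xt₁ := (torEquiv P M hMK).apply_symm_apply xt₁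
  have hxt₂ : toTor P M hMK x₂ = xt₂ := (torEquiv P M hMK).apply_symm_apply xt₂
  have hne' : x₂ ≠ x₁ := by
    intro h
    exact hne (by rw [← hxt₁, ← hxt₂, h])
  -- the source on the tower's fine lattice
  set g : Balaban1983to89.Site P 0 → ℝ := fun z => f (toTor P M hMK z) with hgdef
  have hgF : ∀ z, |g z| ≤ F := fun z => hF _
  have hmain := H P hPd hPL msq hmsq hcap P.K hK le_rfl μ x₁ x₂ hne' g F 0 hgF le_rfl
    (fun z _ => Balaban1983to89.B5Ineq137Torus.T_nonneg P 0 x₁ z)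
    (fun z _ => Balaban1983to89.B5Ineq137Torus.T_nonneg P 0 x₂ z)
  rw [mul_zero, mul_zero, neg_zero, Real.exp_zero, mul_one, weight_eq_rpow_neg P M hMK] at hmain
  rw [← hxt₁, ← hxt₂, fineOp_inv_deriv_mulVec_toTor P M hMK, fineOp_inv_deriv_mulVec_toTor P M hMK]
  exact hmain

/-- **The same WITH THE PRINTED DECAY FROM THE SUPPORT `dist({x₁, x₂}, supp f)`, in block-distance currency**: `∀ 0 ≤ α < 1 ∃ δ₀ c₀ > 0`
such that for EVERY `0 ≤ m² ≤ m₀²`, every volume, any spelling `N = L^K`, every `f` with `|f| ≤ F` vanishing on the fine points whose unit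
block is within torus distance `< D` of the block of `x₁` or of the block of `x₂`, all `x₁ ≠ x₂`, every `μ`:
`(|x₁ − x₂|∕N)^{−α}·|∂^η_μ(A₀⁻¹f)(x₂) − ∂^η_μ(A₀⁻¹f)(x₁)| ≤ c₀·e^{−δ₀D}·F` — [Ba 4] (1.9) `c₀exp(−δ₀ dist({x, x′}, supp f))‖f‖_∞` with
`dist` read on the unit blocks (`T_blk_le_eps_mul`: the block distance is at most the physical distance `+ 2`, the slack `e^{2δ₀}` is
in `c₀`). [cite: Balaban1983RegularityDecay, Theorem (1.9) p.573; King1986, Theorem 3.3 (3.8) p.656] -/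
theorem fineOp_inv_deriv_holder_decay_unif (dd L : ℕ) (hd : 1 ≤ dd) (hL : Odd L ∧ 1 < L) {a : ℝ} (ha : 0 < a)
    {m0sq : ℝ} (hm0 : 0 ≤ m0sq) {α : ℝ} (hα0 : 0 ≤ α) (hα1 : α < 1) :
    ∃ δ₀ c₀ : ℝ, 0 < δ₀ ∧ 0 < c₀ ∧ ∀ (P : Params), P.d = dd → P.L = L → 1 ≤ P.K →
      ∀ (msq : ℝ), 0 ≤ msq → msq ≤ m0sq →
      ∀ (M : Fin P.d → ℕ) [∀ μ, NeZero (M μ)] (_hMK : ∀ μ, M μ = P.sitesPerDir P.K)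
        (N : ℕ) [NeZero N] (_hN : N = P.L ^ P.K) (f : Tor (fine N M) → ℝ) (F D : ℝ), (∀ y, |f y| ≤ F) →
        ∀ (xt₁ xt₂ : Tor (fine N M)), xt₂ ≠ xt₁ →
          (∀ yt, f yt ≠ 0 → D ≤ tdistT M (blockOf N M xt₁) (blockOf N M yt)) →
          (∀ yt, f yt ≠ 0 → D ≤ tdistT M (blockOf N M xt₂) (blockOf N M yt)) →
        ∀ (μ : Fin P.d),
        (tdistT (fine N M) xt₁ xt₂ / N) ^ (-α) *
          |(N : ℝ) * (((fineOp N M (aK a P.L P.K) (((N : ℕ) : ℝ) ^ 2) msq)⁻¹ *ᵥ f) (xt₂ + unitVec (fine N M) μ)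
              - ((fineOp N M (aK a P.L P.K) (((N : ℕ) : ℝ) ^ 2) msq)⁻¹ *ᵥ f) xt₂)
            - (N : ℝ) * (((fineOp N M (aK a P.L P.K) (((N : ℕ) : ℝ) ^ 2) msq)⁻¹ *ᵥ f) (xt₁ + unitVec (fine N M) μ)
              - ((fineOp N M (aK a P.L P.K) (((N : ℕ) : ℝ) ^ 2) msq)⁻¹ *ᵥ f) xt₁)|
          ≤ c₀ * Real.exp (-(δ₀ * D)) * F := by
  obtain ⟨δ₀, c₀, hδ₀, hc₀, H⟩ :=
    Balaban1983to89.B4Thm19ZeroTorus.thm19_zero_torus_unif' dd L hd hL ha hm0 hα0 hα1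
  refine ⟨δ₀, c₀ * Real.exp (2 * δ₀), hδ₀, by positivity, ?_⟩
  intro P hPd hPL hK msq hmsq hcap M _ hMK N _ hN f F D hF xt₁ xt₂ hne hsupp₁ hsupp₂ μ
  subst hN
  set x₁ : Balaban1983to89.Site P 0 := (torEquiv P M hMK).symm xt₁ with hx₁def
  set x₂ : Balaban1983to89.Site P 0 := (torEquiv P M hMK).symm xt₂ with hx₂def
  have hxt₁ : toTor P M hMK x₁ = xt₁ := (torEquiv P M hMK).apply_symm_apply xt₁
  have hxt₂ : toTor P M hMK x₂ = xt₂ := (torEquiv P M hMK).apply_symm_apply xt₂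
  have hne' : x₂ ≠ x₁ := by
    intro h
    exact hne (by rw [← hxt₁, ← hxt₂, h])
  have hε : 0 < P.eps := Params.eps_pos P
  -- the source on the tower's fine lattice and the fine distance fed to (1.9)
  set g : Balaban1983to89.Site P 0 → ℝ := fun z => f (toTor P M hMK z) with hgdef
  have hgF : ∀ z, |g z| ≤ F := fun z => hF _
  set D' : ℝ := max 0 ((D - 2) / P.eps) with hD'def
  have hD'0 : 0 ≤ D' := le_max_left _ _
  have hD'le : ∀ (x : Balaban1983to89.Site P 0), toTor P M hMK x = xt₁ ∨ toTor P M hMK x = xt₂ →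
      ∀ z : Balaban1983to89.Site P 0, g z ≠ 0 → D' ≤ T P 0 x z := by
    intro x hx z hz
    rcases le_total ((D - 2) / P.eps) 0 with h | h
    · rw [hD'def, max_eq_left h]
      exact Balaban1983to89.B5Ineq137Torus.T_nonneg P 0 x z
    · rw [hD'def, max_eq_right h, div_le_iff₀ hε]
      have hdom := T_blk_le_eps_mul P x z
      have hDz : D ≤ tdistT M (blockOf (P.L ^ P.K) M (toTor P M hMK x)) (blockOf (P.L ^ P.K) M (toTor P M hMK z)) := by
        rcases hx with hx | hx
        · rw [hx]; exact hsupp₁ (toTor P M hMK z) hz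
        · rw [hx]; exact hsupp₂ (toTor P M hMK z) hz
      rw [blockOf_toTor P M hMK z, tdistT_blockOf_toTor, ← blk_eq_proj] at hDz
      linarith [mul_comm P.eps (T P 0 x z)]
  have hεD : D - 2 ≤ P.eps * D' := by
    have h1 : P.eps * ((D - 2) / P.eps) ≤ P.eps * D' := mul_le_mul_of_nonneg_left (le_max_right _ _) hε.le
    rwa [mul_div_cancel₀ _ hε.ne'] at h1
  have hmain := H P hPd hPL msq hmsq hcap P.K hK le_rfl μ x₁ x₂ hne' g F D' hgF hD'0
    (hD'le x₁ (Or.inl hxt₁)) (hD'le x₂ (Or.inr hxt₂))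
  have hF0 : 0 ≤ F := (abs_nonneg _).trans (hF xt₁)
  have hexp : Real.exp (-(δ₀ * (P.eps * D'))) ≤ Real.exp (2 * δ₀) * Real.exp (-(δ₀ * D)) := by
    rw [← Real.exp_add]
    apply Real.exp_le_exp.mpr
    nlinarith [mul_le_mul_of_nonneg_left hεD hδ₀.le]
  rw [weight_eq_rpow_neg P M hMK] at hmain
  rw [← hxt₁, ← hxt₂, fineOp_inv_deriv_mulVec_toTor P M hMK, fineOp_inv_deriv_mulVec_toTor P M hMK]
  refine hmain.trans ?_
  calc c₀ * Real.exp (-(δ₀ * (P.eps * D'))) * F ≤ c₀ * (Real.exp (2 * δ₀) * Real.exp (-(δ₀ * D))) * F :=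
        mul_le_mul_of_nonneg_right (mul_le_mul_of_nonneg_left hexp hc₀.le) hF0
    _ = c₀ * Real.exp (2 * δ₀) * Real.exp (-(δ₀ * D)) * F := by ring

/-! ## §3 (1.9) for the KERNEL of `A₀⁻¹` and of King's `G^ε_K = N^d·A₀⁻¹` (point source; block currency) -/

/-- **(1.9) FOR THE KERNEL OF `A₀⁻¹`, block currency, mass-uniform**: `∀ 0 ≤ α < 1 ∃ δ₀ c₀ > 0` with
`(|x₁ − x₂|∕N)^{−α}·|N(A₀⁻¹(x₂ + e_μ, y) − A₀⁻¹(x₂, y)) − N(A₀⁻¹(x₁ + e_μ, y) − A₀⁻¹(x₁, y))| ≤ c₀·e^{−δ₀·min(|B(x₁) − B(y)|_M, |B(x₂) − B(y)|_M)}`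
for EVERY `0 ≤ m² ≤ m₀²`, every volume, all fine `x₁ ≠ x₂`, `y`, `μ` — §2 with the point source `f = δ_y` (`‖f‖_∞ = 1`, support the block of `y`).
The point-source price is honest: as a KERNEL statement this is sharp only at the bottom level `N = L` of the Summits-side induction.
[cite: Balaban1983RegularityDecay, Theorem (1.9) p.573; King1986, Theorem 3.3 (3.8) p.656, Prop. 3.7 (3.65) p.663] -/
theorem fineOp_inv_deriv_holder_kernel_blocks_unif (dd L : ℕ) (hd : 1 ≤ dd) (hL : Odd L ∧ 1 < L) {a : ℝ} (ha : 0 < a)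
    {m0sq : ℝ} (hm0 : 0 ≤ m0sq) {α : ℝ} (hα0 : 0 ≤ α) (hα1 : α < 1) :
    ∃ δ₀ c₀ : ℝ, 0 < δ₀ ∧ 0 < c₀ ∧ ∀ (P : Params), P.d = dd → P.L = L → 1 ≤ P.K →
      ∀ (msq : ℝ), 0 ≤ msq → msq ≤ m0sq →
      ∀ (M : Fin P.d → ℕ) [∀ μ, NeZero (M μ)] (_hMK : ∀ μ, M μ = P.sitesPerDir P.K)
        (N : ℕ) [NeZero N] (_hN : N = P.L ^ P.K) (xt₁ xt₂ yt : Tor (fine N M)), xt₂ ≠ xt₁ → ∀ (μ : Fin P.d),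
        (tdistT (fine N M) xt₁ xt₂ / N) ^ (-α) *
          |(N : ℝ) * ((fineOp N M (aK a P.L P.K) (((N : ℕ) : ℝ) ^ 2) msq)⁻¹ (xt₂ + unitVec (fine N M) μ) yt
              - (fineOp N M (aK a P.L P.K) (((N : ℕ) : ℝ) ^ 2) msq)⁻¹ xt₂ yt)
            - (N : ℝ) * ((fineOp N M (aK a P.L P.K) (((N : ℕ) : ℝ) ^ 2) msq)⁻¹ (xt₁ + unitVec (fine N M) μ) yt
              - (fineOp N M (aK a P.L P.K) (((N : ℕ) : ℝ) ^ 2) msq)⁻¹ xt₁ yt)|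
          ≤ c₀ * Real.exp (-(δ₀ * min (tdistT M (blockOf N M xt₁) (blockOf N M yt))
              (tdistT M (blockOf N M xt₂) (blockOf N M yt)))) := by
  obtain ⟨δ₀, c₀, hδ₀, hc₀, H⟩ := fineOp_inv_deriv_holder_decay_unif dd L hd hL ha hm0 hα0 hα1
  refine ⟨δ₀, c₀, hδ₀, hc₀, ?_⟩
  intro P hPd hPL hK msq hmsq hcap M _ hMK N _ hN xt₁ xt₂ yt hne μ
  have hF : ∀ w, |(Pi.single yt (1 : ℝ) : Tor (fine N M) → ℝ) w| ≤ 1 := by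
    intro w
    by_cases hw : w = yt
    · subst hw; rw [Pi.single_eq_same, abs_one]
    · rw [Pi.single_eq_of_ne hw, abs_zero]; exact zero_le_one
  set D : ℝ := min (tdistT M (blockOf N M xt₁) (blockOf N M yt)) (tdistT M (blockOf N M xt₂) (blockOf N M yt)) with hDdef
  have hsupp : ∀ (xt : Tor (fine N M)), D ≤ tdistT M (blockOf N M xt) (blockOf N M yt) →
      ∀ w, (Pi.single yt (1 : ℝ) : Tor (fine N M) → ℝ) w ≠ 0 → D ≤ tdistT M (blockOf N M xt) (blockOf N M w) := by
    intro xt hxt w hw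
    by_cases h : w = yt
    · subst h; exact hxt
    · exact absurd (Pi.single_eq_of_ne h _) hw
  have hmain := H P hPd hPL hK msq hmsq hcap M hMK N hN (Pi.single yt 1) 1 D hF xt₁ xt₂ hne
    (hsupp xt₁ (min_le_left _ _)) (hsupp xt₂ (min_le_right _ _)) μ
  rw [Matrix.mulVec_single_one, mul_one] at hmain
  exact hmain

/-- **(1.9) FOR KING'S `G^ε_K = N^d·A₀⁻¹` (`constrainedProp`), in lattice units of level `K`**:
`(|x₁ − x₂|∕N)^{−α}·|N(G^ε_K(x₂ + e_μ, y) − G^ε_K(x₂, y)) − N(G^ε_K(x₁ + e_μ, y) − G^ε_K(x₁, y))| ≤ N^d·c₀·e^{−δ₀·min(|B(x₁) − B(y)|, |B(x₂) − B(y)|)}`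
— the Hölder quotient of the forward η-derivative of the kernel in the observation point, with the point-source factor `N^d` (honest; consumed
at `K = 1` by the Summits-side C^{1,α} induction). [cite: Balaban1983RegularityDecay, Theorem (1.9) p.573; King1986, (2.13) p.653, Theorem 3.3 (3.8) p.656, Prop. 3.7 (3.65) p.663, (4.44) p.675] -/
theorem constrainedProp_deriv_holder_blocks_unif (dd L : ℕ) (hd : 1 ≤ dd) (hL : Odd L ∧ 1 < L) {a : ℝ} (ha : 0 < a)
    {m0sq : ℝ} (hm0 : 0 ≤ m0sq) {α : ℝ} (hα0 : 0 ≤ α) (hα1 : α < 1) :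
    ∃ δ₀ c₀ : ℝ, 0 < δ₀ ∧ 0 < c₀ ∧ ∀ (P : Params), P.d = dd → P.L = L → 1 ≤ P.K →
      ∀ (msq : ℝ), 0 ≤ msq → msq ≤ m0sq →
      ∀ (M : Fin P.d → ℕ) [∀ μ, NeZero (M μ)] (_hMK : ∀ μ, M μ = P.sitesPerDir P.K)
        (N : ℕ) [NeZero N] (_hN : N = P.L ^ P.K) (xt₁ xt₂ yt : Tor (fine N M)), xt₂ ≠ xt₁ → ∀ (μ : Fin P.d),
        (tdistT (fine N M) xt₁ xt₂ / N) ^ (-α) *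
          |(N : ℝ) * (constrainedProp N M (aK a P.L P.K) (((N : ℕ) : ℝ) ^ 2) msq (xt₂ + unitVec (fine N M) μ) yt
              - constrainedProp N M (aK a P.L P.K) (((N : ℕ) : ℝ) ^ 2) msq xt₂ yt)
            - (N : ℝ) * (constrainedProp N M (aK a P.L P.K) (((N : ℕ) : ℝ) ^ 2) msq (xt₁ + unitVec (fine N M) μ) yt
              - constrainedProp N M (aK a P.L P.K) (((N : ℕ) : ℝ) ^ 2) msq xt₁ yt)|
          ≤ ((N : ℝ) ^ P.d) * c₀ * Real.exp (-(δ₀ * min (tdistT M (blockOf N M xt₁) (blockOf N M yt))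
              (tdistT M (blockOf N M xt₂) (blockOf N M yt)))) := by
  obtain ⟨δ₀, c₀, hδ₀, hc₀, H⟩ := fineOp_inv_deriv_holder_kernel_blocks_unif dd L hd hL ha hm0 hα0 hα1
  refine ⟨δ₀, c₀, hδ₀, hc₀, ?_⟩
  intro P hPd hPL hK msq hmsq hcap M _ hMK N _ hN xt₁ xt₂ yt hne μ
  have h := H P hPd hPL hK msq hmsq hcap M hMK N hN xt₁ xt₂ yt hne μ
  have hNd : 0 ≤ (N : ℝ) ^ P.d := by positivity
  have hw : 0 ≤ (tdistT (fine N M) xt₁ xt₂ / N) ^ (-α) :=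
    Real.rpow_nonneg (div_nonneg (tdistT_nonneg _ _ _) (Nat.cast_nonneg _)) _
  have hid : (N : ℝ) * (constrainedProp N M (aK a P.L P.K) (((N : ℕ) : ℝ) ^ 2) msq (xt₂ + unitVec (fine N M) μ) yt
          - constrainedProp N M (aK a P.L P.K) (((N : ℕ) : ℝ) ^ 2) msq xt₂ yt)
        - (N : ℝ) * (constrainedProp N M (aK a P.L P.K) (((N : ℕ) : ℝ) ^ 2) msq (xt₁ + unitVec (fine N M) μ) yt
          - constrainedProp N M (aK a P.L P.K) (((N : ℕ) : ℝ) ^ 2) msq xt₁ yt)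
      = (N : ℝ) ^ P.d *
        ((N : ℝ) * ((fineOp N M (aK a P.L P.K) (((N : ℕ) : ℝ) ^ 2) msq)⁻¹ (xt₂ + unitVec (fine N M) μ) yt
            - (fineOp N M (aK a P.L P.K) (((N : ℕ) : ℝ) ^ 2) msq)⁻¹ xt₂ yt)
          - (N : ℝ) * ((fineOp N M (aK a P.L P.K) (((N : ℕ) : ℝ) ^ 2) msq)⁻¹ (xt₁ + unitVec (fine N M) μ) yt
            - (fineOp N M (aK a P.L P.K) (((N : ℕ) : ℝ) ^ 2) msq)⁻¹ xt₁ yt)) := by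
    simp only [constrainedProp, Matrix.smul_apply, smul_eq_mul]
    ring
  rw [hid, abs_mul, abs_of_nonneg hNd, mul_left_comm, mul_assoc]
  exact mul_le_mul_of_nonneg_left h hNd

end Torus

end Literature.MathematicalPhysics.QuantumFieldTheory.King1986
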